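import Literature.AlgebraicGeometry.Resolution.AlterationsLemma411Projection
import Literature.Topology.KrullDimensionDrop
import HarnessLib

/-!
# De Jong's alteration theorem, proof of Lemma 4.11: the smooth locus of `f` is dense in all fibres

Topic: `Literature/AlgebraicGeometry/Resolution`. DISCHARGES the named fact
`DeJong1996Lemma411SmoothLocusDense` of `AlterationsLemma411Projection.lean` — Lemma 4.11 (ii) b)
of de Jong 1996 for the construction `X' = X ×_{ℙ^{d+1}} P̃`, `f = pr₂ ≫ q`:

> "Any component of `π⁻¹(ℓ)` is finite over `ℓ`, hence contains one of the points of
> `π⁻¹({p})`. Thus it suffices to show that `f` is smooth along the exceptional fibres `E_i` of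
> `X' → X`. Locally in the étale topology, `f` along `E_i` looks like `pr_p : P̃^d → ℙ^{d-1}`
> along the exceptional fibre of the blowing up `P̃^d → ℙ^d` of `ℙ^d` in `p`." (p. 68)

The proof is written for an arbitrary diagram `X —π→ T ←b— P —q→ B` of schemes (in 4.11:
`T = ℙ^{d+1}`, `B = ℙ^d`, `b` the blowing up in `p`, `q = pr_p`), `X' = X ×_T P`,
`π' = pr₂ : X' → P`, `f = π' ≫ q`:

* `mem_smoothLocus_of_apply_mem` — **`f` is smooth along the exceptional fibres**: if `π` is
  étale over the open `V ⊆ T` and `q` is smooth, every point of `X'` lying over `V` is in the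
  smooth locus of `f` (`π'` is étale over `b⁻¹V` as a base change of `π|_{π⁻¹V}`, and
  `smooth ∘ étale` is smooth);
* `image_eq_univ_of_isFinite_of_topologicalKrullDim_eq_one` — **"Any component of `π⁻¹(ℓ)` is
  finite over `ℓ`, hence"** maps ONTO `ℓ`: for a finite morphism `g : F → G` to an irreducible
  scheme of dimension `≤ 1`, every irreducible component `C` of `F` of dimension `1` has
  `g(C) = G` (otherwise `g(C)` is a proper closed subset, of dimension `< 1`, and finite
  morphisms do not lower the dimension of closed subsets: incomparability);
* `dense_of_forall_inter_nonempty` — an open subset meeting every irreducible component is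
  dense;
* `dense_preimage_smoothLocus_fiber` — the generic form of (ii) b): if moreover every fibre
  `q⁻¹(y)` is irreducible of dimension `≤ 1` and meets `b⁻¹(p)`, `p ∈ V`, and all fibres of `f`
  are equidimensional of dimension `1`, then `sm(f)` is dense in every fibre `f⁻¹(y)` (the fibre
  `f⁻¹(y) → q⁻¹(y)` of `π'` is finite, so every component of `f⁻¹(y)` reaches the point of
  `q⁻¹(y)` over `p`, where `f` is smooth);
* `DeJong1996Lemma411SmoothLocusDense_holds` — the named fact DISCHARGED (`f` is locally of
  finite presentation since `π'` is finite over the locally Noetherian `P̃` and `q` is smooth).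

## Sources

* A. J. de Jong, *Smoothness, semi-stability and alterations*, Publ. Math. IHÉS 83 (1996),
  Lemma 4.11 (ii) b) and its proof, pp. 67–68. [DeJong1996]
* The Stacks Project, Tag 0ECG (dimension and integral morphisms), Tag 01V5 (smooth locus).
-/

noncomputable section

open CategoryTheory CategoryTheory.Limits AlgebraicGeometry TopologicalSpace Topology

namespace Literature.AlgebraicGeometry.Resolution

universe u

/-! ## Topology: open sets meeting all irreducible components -/

/-- An open subset of a topological space which meets every irreducible component is dense:
its trace on each component is a non-empty open subset of an irreducible set, hence dense in
it, and the components cover the space. [folklore] -/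
theorem dense_of_forall_inter_nonempty {α : Type*} [TopologicalSpace α] {U : Set α}
    (hU : IsOpen U) (h : ∀ C ∈ irreducibleComponents α, (C ∩ U).Nonempty) : Dense U := by
  intro x
  have hC := irreducibleComponent_mem_irreducibleComponents x
  have hsub : irreducibleComponent x ⊆ closure (irreducibleComponent x ∩ U) :=
    subset_closure_inter_of_isPreirreducible_of_isOpen
      (isIrreducible_irreducibleComponent).isPreirreducible hU (h _ hC)
  exact closure_mono Set.inter_subset_right (hsub mem_irreducibleComponent)

/-! ## Finite morphisms: one-dimensional components surject onto a curve -/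

/-- **"Any component of `π⁻¹(ℓ)` is finite over `ℓ`, hence" maps onto `ℓ`** (de Jong 1996, proof
of 4.11): let `g : F → G` be a finite morphism of schemes with `G` irreducible of dimension
`≤ 1`, and `C` an irreducible component of `F` of dimension `1`. Then `g(C) = G`. Indeed `g(C)`
is closed; were it a proper subset of the irreducible `G`, its dimension would be `< 1`
(`Literature.Topology.topologicalKrullDim_lt_of_isClosed_ssubset`), whereas `dim C ≤ dim g(C)`
because `g` has discrete fibres (incomparability,
`Literature.Topology.topologicalKrullDim_le_rangeFactorization`).
[cite: DeJong1996, Lemma 4.11 (proof), p. 68] -/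
theorem image_eq_univ_of_isFinite_of_topologicalKrullDim_eq_one {F G : Scheme.{u}} (g : F ⟶ G)
    [IsFinite g] [IrreducibleSpace G] (hG : topologicalKrullDim G ≤ 1) {C : Set F}
    (hC : C ∈ irreducibleComponents F) (hC1 : topologicalKrullDim C = 1) :
    g '' C = Set.univ := by
  by_contra hne
  have hCcl : IsClosed C := isClosed_of_mem_irreducibleComponents C hC
  have himg : IsClosed (g '' C) := g.isClosedMap C hCcl
  -- `dim g(C) < 1`
  have hlt : topologicalKrullDim (g '' C) < (1 : ℕ) := by
    refine Literature.Topology.topologicalKrullDim_lt_of_isClosed_ssubset himg hne 1 ?_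
    exact lt_of_le_of_lt hG (by exact_mod_cast WithBot.coe_lt_coe.mpr (by decide))
  -- `dim C ≤ dim g(C)` by incomparability along the finite `g`
  haveI : QuasiSober C := Literature.Topology.quasiSober_of_isClosed hCcl
  have hrange : Set.range (g ∘ ((↑) : C → F)) = g '' C := by
    rw [Set.range_comp, Subtype.range_coe]
  have hle : topologicalKrullDim C ≤ topologicalKrullDim (Set.range (g ∘ ((↑) : C → F))) := by
    refine Literature.Topology.topologicalKrullDim_le_rangeFactorization
      (g.continuous.comp continuous_subtype_val) (by rw [hrange]; exact himg) ?_
    intro a c hac hgac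
    have hS := g.isDiscrete_preimage_singleton (g c)
    rw [isDiscrete_iff_discreteTopology] at hS
    have hac' : (a : F) ⤳ (c : F) := (subtype_specializes_iff a c).1 hac
    have h : (⟨(a : F), hgac⟩ : g ⁻¹' {g c}) ⤳ ⟨c, rfl⟩ := by
      rw [subtype_specializes_iff]
      exact hac'
    have hval := h.eq
    simp only [Subtype.mk.injEq] at hval
    exact Subtype.ext hval
  rw [hrange] at hle
  rw [hC1] at hle
  exact absurd (lt_of_le_of_lt hle hlt) (lt_irrefl _)

/-! ## `f` is smooth over `V` -/

section Construction

variable {X T P B : Scheme.{u}} (π : X ⟶ T) (b : P ⟶ T) (q : P ⟶ B)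

/-- **`f` is smooth along the exceptional fibres** (de Jong 1996, proof of 4.11: "Locally in
the étale topology, `f` along `E_i` looks like `pr_p : P̃^d → ℙ^{d-1}`"): for
`X' = X ×_T P`, `π' = pr₂`, `f = π' ≫ q` with `q` smooth and `π` étale over the open `V ⊆ T`,
every point of `X'` over `V` lies in the smooth locus of `f` — over `V`, `π'` is a base change
of the étale `π|_{π⁻¹V}`, and `f = q ∘ π'` is smooth there.
[cite: DeJong1996, Lemma 4.11 (proof), p. 68] -/
theorem mem_smoothLocus_of_apply_mem [Smooth q] (V : T.Opens) [Etale (π ∣_ V)]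
    [LocallyOfFinitePresentation (pullback.snd π b ≫ q)] {x : ↥(pullback π b)}
    (hx : π (pullback.fst π b x) ∈ V) : x ∈ (pullback.snd π b ≫ q).smoothLocus := by
  let U : X.Opens := π ⁻¹ᵁ V
  let W : (pullback π b).Opens := pullback.fst π b ⁻¹ᵁ U
  have hxW : x ∈ W := hx
  have h1 : Etale (U.ι ≫ π) := by
    rw [← morphismRestrict_ι]
    infer_instance
  have sq : IsPullback (W.ι ≫ pullback.snd π b) (pullback.fst π b ∣_ U) b (U.ι ≫ π) :=
    (isPullback_morphismRestrict (pullback.fst π b) U).flip.paste_horiz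
      (IsPullback.of_hasPullback π b).flip
  have h2 : Etale (W.ι ≫ pullback.snd π b) :=
    MorphismProperty.of_isPullback (P := @Etale) sq.flip h1
  have h3 : Smooth (W.ι ≫ (pullback.snd π b ≫ q)) := by
    rw [← Category.assoc]
    infer_instance
  have h4 : W.ι ⁻¹ᵁ (pullback.snd π b ≫ q).smoothLocus = ⊤ := by
    rw [Scheme.Hom.preimage_smoothLocus_eq, Scheme.Hom.smoothLocus_eq_top]
  have hmem : (⟨x, hxW⟩ : ↥W) ∈ W.ι ⁻¹ᵁ (pullback.snd π b ≫ q).smoothLocus := by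
    rw [h4]
    trivial
  change W.ι ⟨x, hxW⟩ ∈ (pullback.snd π b ≫ q).smoothLocus at hmem
  exact hmem

/-! ## The smooth locus is dense in every fibre -/

/-- **de Jong 1996, Lemma 4.11 (ii) b), generic form.** Let `X —π→ T ←b— P —q→ B` be schemes
with `π` finite and étale over the open `V ∋ p` of `T`, `q` smooth with every fibre `q⁻¹(y)`
irreducible of dimension `≤ 1` and meeting `b⁻¹(p)`; put `X' = X ×_T P`, `f = pr₂ ≫ q`, and
assume `f` is locally of finite presentation with all fibres equidimensional of dimension `1`.
Then the smooth locus of `f` is dense in every fibre `f⁻¹(y)`: the morphism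
`f⁻¹(y) → q⁻¹(y)` induced by `pr₂` is finite (a base change of `π`), so every irreducible
component of `f⁻¹(y)` maps onto `q⁻¹(y)` and therefore contains a point over `b⁻¹(p)`, at
which `f` is smooth; an open subset of the fibre meeting all its components is dense.
[cite: DeJong1996, Lemma 4.11 (proof), p. 68] -/
theorem dense_preimage_smoothLocus_fiber [IsFinite π] [Smooth q] (V : T.Opens)
    [Etale (π ∣_ V)] {p : T} (hpV : p ∈ V) (hirr : ∀ y : B, IrreducibleSpace ↥(q.fiber y))
    (hdimq : ∀ y : B, topologicalKrullDim ↥(q.fiber y) ≤ 1)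
    (hE : ∀ y : B, ∃ e : P, b e = p ∧ q e = y)
    [LocallyOfFinitePresentation (pullback.snd π b ≫ q)]
    (hdim1 : ∀ (y : B), ∀ C ∈ irreducibleComponents ↥((pullback.snd π b ≫ q).fiber y),
      topologicalKrullDim C = 1)
    (y : B) :
    Dense (((pullback.snd π b ≫ q).fiberι y) ⁻¹'
      (((pullback.snd π b ≫ q).smoothLocus : (pullback π b).Opens) : Set ↥(pullback π b))) := by
  set π' := pullback.snd π b with hπ'
  set f := π' ≫ q with hf
  -- the fibre `F = f⁻¹(y)` maps to the fibre `G = q⁻¹(y)` by a base change `g` of `π'`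
  let g : f.fiber y ⟶ q.fiber y :=
    pullback.lift (f.fiberι y ≫ π') (f.fiberToSpecResidueField y)
      (by rw [Category.assoc, ← hf, Scheme.Hom.fiber_fac])
  have hg₁ : g ≫ q.fiberι y = f.fiberι y ≫ π' := pullback.lift_fst _ _ _
  have hg₂ : g ≫ q.fiberToSpecResidueField y = f.fiberToSpecResidueField y :=
    pullback.lift_snd _ _ _
  have s0 : IsPullback (f.fiberι y) (f.fiberToSpecResidueField y) f
      (B.fromSpecResidueField y) := IsPullback.of_hasPullback _ _
  have t0 : IsPullback (q.fiberι y) (q.fiberToSpecResidueField y) q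
      (B.fromSpecResidueField y) := IsPullback.of_hasPullback _ _
  have s : IsPullback (g ≫ q.fiberToSpecResidueField y) (f.fiberι y)
      (B.fromSpecResidueField y) (π' ≫ q) := by
    rw [hg₂]
    exact s0.flip
  have sq : IsPullback g (f.fiberι y) (q.fiberι y) π' := IsPullback.of_right s hg₁ t0.flip
  haveI : IsFinite g := MorphismProperty.of_isPullback (P := @IsFinite) sq.flip inferInstance
  haveI := hirr y
  -- the open subset of the fibre where `f` is smooth meets every irreducible component
  refine dense_of_forall_inter_nonempty
    ((pullback.snd π b ≫ q).smoothLocus.isOpen.preimage (f.fiberι y).continuous) ?_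
  intro C hC
  have himg := image_eq_univ_of_isFinite_of_topologicalKrullDim_eq_one g (hdimq y) hC
    (hdim1 y C hC)
  -- the point of `q⁻¹(y)` over `p`
  obtain ⟨e, hbe, hqe⟩ := hE y
  have he : e ∈ Set.range (q.fiberι y) := by
    rw [Scheme.Hom.range_fiberι]
    exact hqe
  obtain ⟨e', he'⟩ := he
  have he'C : e' ∈ g '' C := by
    rw [himg]
    trivial
  obtain ⟨c, hcC, hgc⟩ := he'C
  refine ⟨c, hcC, ?_⟩
  -- `f` is smooth at the image of `c` in `X'`, a point over `p ∈ V`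
  change f.fiberι y c ∈ ((pullback.snd π b ≫ q).smoothLocus : Set ↥(pullback π b))
  apply mem_smoothLocus_of_apply_mem π b q V
  have h1 : π' (f.fiberι y c) = e := by
    rw [← Scheme.Hom.comp_apply, ← hg₁, Scheme.Hom.comp_apply, hgc, he']
  have h2 : π (pullback.fst π b (f.fiberι y c)) = b (π' (f.fiberι y c)) := by
    rw [← Scheme.Hom.comp_apply, pullback.condition, Scheme.Hom.comp_apply]
  rw [h2, h1, hbe]
  exact hpV

end Construction

/-! ## (ii) b) discharged -/

open Literature.AlgebraicGeometry.Motives (projectiveSpace) in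
/-- **`DeJong1996Lemma411SmoothLocusDense` DISCHARGED** (de Jong 1996, Lemma 4.11 (ii) b) for
`X' = X ×_{ℙ^{d+1}} P̃`, `f = pr₂ ≫ q`): `f` is locally of finite presentation — `pr₂` is finite,
a base change of `π`, with target the locally Noetherian `P̃` (proper over `ℙ^{d+1}_k` as a
blowing up, `IsBlowup.isProper`), and `q` is smooth — and its smooth locus is dense in every
fibre by `dense_preimage_smoothLocus_fiber`, fed with the étale neighbourhood `V ∋ p` of
`DeJong1996.Lemma411Projection` and the fibre properties of `DeJong1996.PointBlowupProjection`.
[cite: DeJong1996, Lemma 4.11 (ii) b) and proof, pp. 67–68] -/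
theorem DeJong1996Lemma411SmoothLocusDense_holds : DeJong1996Lemma411SmoothLocusDense.{u} := by
  intro k _ _ X fX Z d π p P b q _ hX hπ hM hdim1
  obtain ⟨V, hpV, hV⟩ := hπ.exists_etale_morphismRestrict
  haveI := hV
  haveI := hπ.isFinite
  haveI := hM.smooth
  haveI : IsProper (projectiveSpace (d + 1) k).hom :=
    Literature.AlgebraicGeometry.Motives.isProper_projectiveSpace (d + 1) k
  haveI : IsLocallyNoetherian (projectiveSpace (d + 1) k).left :=
    LocallyOfFiniteType.isLocallyNoetherian (projectiveSpace (d + 1) k).hom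
  haveI : IsProper b := hM.isBlowup.isProper
  haveI : IsLocallyNoetherian P := LocallyOfFiniteType.isLocallyNoetherian b
  haveI : LocallyOfFinitePresentation (pullback.snd π b ≫ q) := inferInstance
  exact ⟨inferInstance, fun y => dense_preimage_smoothLocus_fiber π b q V hpV
    hM.irreducibleSpace_fiber hM.topologicalKrullDim_fiber_le_one hM.exists_apply_eq hdim1 y⟩

end Literature.AlgebraicGeometry.Resolution

end
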